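import Summits.QuantumFields.YangMills.Theorems.BalabanUVNodesN18AllRunsBundle
import Literature.MathematicalPhysics.QuantumFieldTheory.Balaban1983to89.Node00.RateRecordW1MapsAdm

/-!
# BalabanUVNodes ∕ node N18 = NE5 — THE PIN-FORM ROWS AT A STAGE-13 READING PINNED TO ALL-RUNS OBJECTS, AND THE «BACKGROUND FOR EVERY RUN» HYPOTHESES OF THE
# ALL-RUNS DICTIONARY DISCHARGED AT W1's PAIRINGS OF RECORD (`ReadingData.ofRecord`, `ReadingData.ofRecordAdm`)

Cell `pub-ymgap`, width seat `pub-ymgap-dag-n18-w2` (HUMAN RULING D-0149 ∕ director-ym №197; plan `W-SEAT-START-LIST` §n18 ITEM 2), fourth module, PROOF lane (0 `def`):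
the pin-form companion of `Theorems/BalabanUVNodesN18AllRunsBundle` (p587538) for the witness shape the plan's K3 v2 draft-2 names («the `𝔯` of stub 1 must carry an
ALL-RUNS node-U3 object at the selected level»), in dag-n18-d's `(𝔯, W, hpin)` idiom of `Theorems/BalabanUVNodesN18AtRateRecord13CoPH`.  `--supports
stmt-QuantumFields-20544` (K3⁷) AS A HELPER — count-neutral.

WHAT IS PROVED (kernel bookkeeping BY NAME; nothing of Bałaban's asserted).
* §1 PIN-FORM ROWS.  For ANY Stage-13 rate reading `𝔯` whose node-U3 objects are PINNED to the all-runs objects of a W1 reading family `W F θ`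
  (`hpin : (𝔯.lit F θ hP g₀ os).u3 = (W F θ).u3ObjectsAllRuns θ.γ`): `s_N18_rRec₁₃CoPH_iff_of_allRuns_pin` (`S_N18 (RRec₁₃CoPH 𝔯)` ⟺ `N18At` for the ONE all-runs bundle at every
  datum key), `s_N18_rRec₁₃CoPH_allRuns_pin_iff_levels` (⟺ `N18At` at EVERY run-length level of `W`, given a run-B background for every run), the `S_N22` twins,
  `s_D4_rRec₁₃CoPH_iff_of_allRuns_pin` (ONE `ReadOutAt` per datum key — the keying at which (D4) does not degenerate β, `U3Guards` §3 ∕ `AllRunsBundle`).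
* §2 THE BACKGROUNDS OF W1's PAIRINGS OF RECORD ARE INHABITED: at `ReadingData.ofRecord` both run sides are gauge-field TYPES (`PBond → SU(N)`, inhabited by the unit
  field); at `ReadingData.ofRecordAdm` they are the admissible subtypes `AdmBg … sp K`, inhabited as soon as ONE field reads inside every space of the table
  (`AdmBg.nonempty_of_mem`; in tree for the plaquette-small ∕ envelope ∕ generated tables: `admBg_plaqSmall_nonempty`, `admBg_plaqEnvelope_alphaL_nonempty`,
  `admBg_spGen_nonempty_of_strict`).
* §3 HENCE THE ALL-RUNS ⟺ PER-LEVEL DICTIONARY READS HYPOTHESIS-FREE at `ReadingData.ofRecord` (`n18At_allRuns_ofRecord_iff`, `n22At_allRuns_ofRecord_iff`,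
  `sensitiveOnBoxes_allRuns_ofRecord_iff`) and under table inhabitation at `ReadingData.ofRecordAdm` (`n18At_allRuns_ofRecordAdm_iff`, `n22At_allRuns_ofRecordAdm_iff`).

HONEST FRAMING.  Count-neutral helper; W1's towers `S K` RESIDUAL (N10's (2.14) objects not instantiated); nothing of Bałaban's asserted; NE5 ∕ NE9 ∕ (D4) NOT PRINTED for
d = 4 and NOT proved; N18 ∕ N22 NOT discharged; K3⁷ OPEN, not claimed; counts UNMOVED (typed 28∕28 · discharged 5∕27 (A 5∕28)).  One finite four-torus programme at fixed `ε`,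
Bałaban as printed; R4 closes the conditional finite-𝕋⁴ rung `BalabanLadder.UV` only — NOT ℝ⁴, NOT infinite volume, NOT OS, NOT a mass gap, NOT Clay.  No `def`, no `sorry`.
-/

set_option autoImplicit false

noncomputable section

namespace YMDAG.N18.AllRunsPinned

open Literature.MathematicalPhysics.QuantumFieldTheory.Balaban1983to89
open Literature.MathematicalPhysics.QuantumFieldTheory.Balaban1983to89.T4Continuum
open Literature.MathematicalPhysics.QuantumFieldTheory.Balaban1983to89.Node00 (Stage13Params Stage13HParams IsDatumOfRecord₁₃CCoPH MatA ιSU)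
open Literature.MathematicalPhysics.QuantumFieldTheory.Balaban1983to89.Node00.Sect2 (domSys CPair ofBackgroundC)
open Literature.MathematicalPhysics.QuantumFieldTheory.Balaban1983to89.Node00.W1 (ReadingData LetterInputs ClusterTower AdmBg)
open YMDAG.UVSplit
open YMDAG.N18.U3Guards (SensitiveOnBoxes)
open YMDAG.N18.AllRunsBundle

variable {N : ℕ} [NeZero N]

/-! ## §1 The K4 stubs at a reading PINNED to all-runs objects -/

section Pinned

variable (𝔯 : RateReading₁₃CoPH N) (W : (F : T4Family) → (θ : Stage13HParams F N) → ReadingData F (MatA N) θ.τ9.M)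
  (hpin : ∀ (F : T4Family) (θ : Stage13HParams F N) (hP : θ.Provisos₁₃CoPH F N) (g₀ : ℕ → ℝ) (os : List (ULoop F)),
    (𝔯.lit F θ hP g₀ os).u3 = (W F θ).u3ObjectsAllRuns θ.γ)

include hpin in
/-- **`S_N18` AT A READING PINNED TO ALL-RUNS OBJECTS, CLOSED FORM**: `N18At` for the ONE all-runs bundle of `W F θ` at every Stage-13 datum key (`g₀`, `os`, the run
length idle — `AllRunsBundle.u3OfRecord₁₃_allRuns_eq`). [folklore] -/
theorem s_N18_rRec₁₃CoPH_iff_of_allRuns_pin :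
    S_N18 (RRec₁₃CoPH 𝔯) ↔
      ∀ (F : T4Family) (D : Datum F N) (h : IsDatumOfRecord₁₃CCoPH F N D),
        N18At (u3OfRecord₁₃ h.params.toStage13Params ((W F h.params).u3ObjectsAllRuns h.params.γ) 0) := by
  rw [s_N18_rRec₁₃CoPH_iff]
  refine ⟨fun H F D h => ?_, fun H F D h g₀ os k => ?_⟩
  · have h₁ := H F D h (fun _ => 0) [] 0
    rwa [hpin] at h₁
  · rw [hpin, u3OfRecord₁₃_allRuns_eq h.params.toStage13Params (W F h.params) h.params.γ k 0]
    exact H F D h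

include hpin in
/-- **… ⟺ `N18At` AT EVERY RUN-LENGTH LEVEL OF `W`**, given a run-B background for every run (`AllRunsBundle.n18At_u3OfRecord₁₃_allRuns_iff`). [folklore] -/
theorem s_N18_rRec₁₃CoPH_allRuns_pin_iff_levels (hB : ∀ (F : T4Family) (θ : Stage13HParams F N) (K : ℕ), Nonempty ((W F θ).pairing K).BgB) :
    S_N18 (RRec₁₃CoPH 𝔯) ↔
      ∀ (F : T4Family) (D : Datum F N) (h : IsDatumOfRecord₁₃CCoPH F N D) (K : ℕ),
        N18At (u3OfRecord₁₃ h.params.toStage13Params ((W F h.params).u3Objects h.params.γ) K) := by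
  rw [s_N18_rRec₁₃CoPH_iff_of_allRuns_pin 𝔯 W hpin]
  refine ⟨fun H F D h K => ?_, fun H F D h => ?_⟩
  · exact (n18At_u3OfRecord₁₃_allRuns_iff h.params.toStage13Params (W F h.params) h.params.γ (hB F h.params) 0).mp (H F D h) K
  · exact n18At_u3OfRecord₁₃_allRuns_of_forall h.params.toStage13Params (W F h.params) h.params.γ 0 fun K => H F D h K

include hpin in
/-- **`S_N22` AT A READING PINNED TO ALL-RUNS OBJECTS, CLOSED FORM.** [folklore] -/
theorem s_N22_rRec₁₃CoPH_iff_of_allRuns_pin :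
    S_N22 (RRec₁₃CoPH 𝔯) ↔
      ∀ (F : T4Family) (D : Datum F N) (h : IsDatumOfRecord₁₃CCoPH F N D),
        N22At (u3OfRecord₁₃ h.params.toStage13Params ((W F h.params).u3ObjectsAllRuns h.params.γ) 0) := by
  rw [s_N22_rRec₁₃CoPH_iff]
  refine ⟨fun H F D h => ?_, fun H F D h g₀ os k => ?_⟩
  · have h₁ := H F D h (fun _ => 0) [] 0
    rwa [hpin] at h₁
  · rw [hpin, u3OfRecord₁₃_allRuns_eq h.params.toStage13Params (W F h.params) h.params.γ k 0]
    exact H F D h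

include hpin in
/-- **… ⟺ `N22At` AT EVERY RUN-LENGTH LEVEL OF `W`**, given a run-A background for every run. [folklore] -/
theorem s_N22_rRec₁₃CoPH_allRuns_pin_iff_levels (hA : ∀ (F : T4Family) (θ : Stage13HParams F N) (K : ℕ), Nonempty ((W F θ).pairing K).BgA) :
    S_N22 (RRec₁₃CoPH 𝔯) ↔
      ∀ (F : T4Family) (D : Datum F N) (h : IsDatumOfRecord₁₃CCoPH F N D) (K : ℕ),
        N22At (u3OfRecord₁₃ h.params.toStage13Params ((W F h.params).u3Objects h.params.γ) K) := by
  rw [s_N22_rRec₁₃CoPH_iff_of_allRuns_pin 𝔯 W hpin]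
  refine ⟨fun H F D h K => ?_, fun H F D h => ?_⟩
  · exact (n22At_u3OfRecord₁₃_allRuns_iff h.params.toStage13Params (W F h.params) h.params.γ (hA F h.params) 0).mp (H F D h) K
  · exact n22At_u3OfRecord₁₃_allRuns_of_forall h.params.toStage13Params (W F h.params) h.params.γ 0 fun K => H F D h K

include hpin in
/-- **`S_D4` AT A READING PINNED TO ALL-RUNS OBJECTS IS ONE (D4) SENTENCE PER DATUM KEY** — `ReadOutAt` for the ONE all-runs bundle (the run length idle): the keying at
which (D4) does not force β-blindness (`U3Guards.beta_eq_of_readOutAt_runLevel` is about run-TOWER levels). [folklore] -/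
theorem s_D4_rRec₁₃CoPH_iff_of_allRuns_pin :
    S_D4 (RRec₁₃CoPH 𝔯) ↔
      ∀ (F : T4Family) (D : Datum F N) (h : IsDatumOfRecord₁₃CCoPH F N D),
        ReadOutAt D (u3OfRecord₁₃ h.params.toStage13Params ((W F h.params).u3ObjectsAllRuns h.params.γ) 0) := by
  rw [s_D4_rRec₁₃CoPH_iff]
  refine ⟨fun H F D h => ?_, fun H F D h g₀ os k => ?_⟩
  · have h₁ := H F D h (fun _ => 0) [] 0
    rwa [hpin] at h₁
  · rw [hpin, u3OfRecord₁₃_allRuns_eq h.params.toStage13Params (W F h.params) h.params.γ k 0]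
    exact H F D h

end Pinned

/-! ## §2 The backgrounds of W1's pairings of record are inhabited -/

section Backgrounds

variable (F : T4Family) (M : ℕ)

/-- At the pairing of record, run A's backgrounds (`SU(N)`-valued gauge fields on the fine lattice of `F.P K`) are inhabited. [folklore] -/
theorem nonempty_bgA_pairing_ofRecord (S : (k : ℕ) → ClusterTower (F.P k) (MatA N) M)
    (gauge : (k : ℕ) → GaugeField (F.P k) 0 (Node00.SU N) → GaugeField (F.P k) 0 (Node00.SU N) → ℝ) (hg : ∀ k U U', 0 ≤ gauge k U U')
    (T : (k : ℕ) → GaugeField (F.P (k + 1)) 0 (Node00.SU N) → GaugeField (F.P k) 0 (Node00.SU N)) (li : LetterInputs) (K : ℕ) :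
    Nonempty ((ReadingData.ofRecord F M N S gauge hg T li).pairing K).BgA :=
  (inferInstance : Nonempty (GaugeField (F.P K) 0 (Node00.SU N)))

/-- At the pairing of record, run B's backgrounds (gauge fields on `F.P (K+1)`) are inhabited. [folklore] -/
theorem nonempty_bgB_pairing_ofRecord (S : (k : ℕ) → ClusterTower (F.P k) (MatA N) M)
    (gauge : (k : ℕ) → GaugeField (F.P k) 0 (Node00.SU N) → GaugeField (F.P k) 0 (Node00.SU N) → ℝ) (hg : ∀ k U U', 0 ≤ gauge k U U')
    (T : (k : ℕ) → GaugeField (F.P (k + 1)) 0 (Node00.SU N) → GaugeField (F.P k) 0 (Node00.SU N)) (li : LetterInputs) (K : ℕ) :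
    Nonempty ((ReadingData.ofRecord F M N S gauge hg T li).pairing K).BgB :=
  (inferInstance : Nonempty (GaugeField (F.P (K + 1)) 0 (Node00.SU N)))

variable (S : (k : ℕ) → ClusterTower (F.P k) (MatA N) M) (sp : (k j : ℕ) → (domSys (F.P k) M j).Dom → Set (CPair (F.P k) (MatA N)))
  (gauge : (k : ℕ) → GaugeField (F.P k) 0 (Node00.SU N) → GaugeField (F.P k) 0 (Node00.SU N) → ℝ) (hg : ∀ k U U', 0 ≤ gauge k U U')
  (T₀ : (k : ℕ) → GaugeField (F.P (k + 1)) 0 (Node00.SU N) → GaugeField (F.P k) 0 (Node00.SU N))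
  (hT₀ : ∀ (k : ℕ) (U : GaugeField (F.P (k + 1)) 0 (Node00.SU N)), (∀ (j : ℕ) (Y : (domSys (F.P (k + 1)) M j).Dom), ofBackgroundC (ιSU N) U ∈ sp (k + 1) j Y) →
    ∀ (j : ℕ) (Y : (domSys (F.P k) M j).Dom), ofBackgroundC (ιSU N) (T₀ k U) ∈ sp k j Y)
  (li : LetterInputs)

omit [NeZero N] in
/-- At the ADMISSIBLE pairing of record, run A's backgrounds are inhabited as soon as ONE field reads inside every space of the table at run `K` (`AdmBg.nonempty_of_mem`).
[folklore] -/
theorem nonempty_bgA_pairing_ofRecordAdm (K : ℕ)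
    (hsp : ∃ U₀ : GaugeField (F.P K) 0 (Node00.SU N), ∀ (j : ℕ) (Y : (domSys (F.P K) M j).Dom), ofBackgroundC (ιSU N) U₀ ∈ sp K j Y) :
    Nonempty ((ReadingData.ofRecordAdm F M N S sp gauge hg T₀ hT₀ li).pairing K).BgA := by
  obtain ⟨U₀, hU₀⟩ := hsp
  exact AdmBg.nonempty_of_mem F M N U₀ hU₀

omit [NeZero N] in
/-- At the ADMISSIBLE pairing of record, run B's backgrounds are inhabited as soon as ONE field reads inside every space of the table at run `K + 1`. [folklore] -/
theorem nonempty_bgB_pairing_ofRecordAdm (K : ℕ)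
    (hsp : ∃ U₀ : GaugeField (F.P (K + 1)) 0 (Node00.SU N), ∀ (j : ℕ) (Y : (domSys (F.P (K + 1)) M j).Dom), ofBackgroundC (ιSU N) U₀ ∈ sp (K + 1) j Y) :
    Nonempty ((ReadingData.ofRecordAdm F M N S sp gauge hg T₀ hT₀ li).pairing K).BgB := by
  obtain ⟨U₀, hU₀⟩ := hsp
  exact AdmBg.nonempty_of_mem F M N U₀ hU₀

end Backgrounds

/-! ## §3 The all-runs ⟺ per-level dictionary, hypothesis-free at the pairings of record -/

section Dictionary

variable {F : T4Family} (θ : Stage13Params F N) (M : ℕ) (γ : ℝ)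

/-- **`N18At` AT THE ALL-RUNS BUNDLE OF THE READING OF RECORD ⟺ AT EVERY RUN-LENGTH LEVEL** — no inhabitant hypothesis left. [folklore] -/
theorem n18At_allRuns_ofRecord_iff (S : (k : ℕ) → ClusterTower (F.P k) (MatA N) M)
    (gauge : (k : ℕ) → GaugeField (F.P k) 0 (Node00.SU N) → GaugeField (F.P k) 0 (Node00.SU N) → ℝ) (hg : ∀ k U U', 0 ≤ gauge k U U')
    (T : (k : ℕ) → GaugeField (F.P (k + 1)) 0 (Node00.SU N) → GaugeField (F.P k) 0 (Node00.SU N)) (li : LetterInputs) (k : ℕ) :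
    N18At (u3OfRecord₁₃ θ ((ReadingData.ofRecord F M N S gauge hg T li).u3ObjectsAllRuns γ) k) ↔
      ∀ K, N18At (u3OfRecord₁₃ θ ((ReadingData.ofRecord F M N S gauge hg T li).u3Objects γ) K) :=
  n18At_u3OfRecord₁₃_allRuns_iff θ _ γ (nonempty_bgB_pairing_ofRecord F M S gauge hg T li) k

/-- **`N22At` AT THE ALL-RUNS BUNDLE OF THE READING OF RECORD ⟺ AT EVERY RUN-LENGTH LEVEL** — no inhabitant hypothesis left. [folklore] -/
theorem n22At_allRuns_ofRecord_iff (S : (k : ℕ) → ClusterTower (F.P k) (MatA N) M)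
    (gauge : (k : ℕ) → GaugeField (F.P k) 0 (Node00.SU N) → GaugeField (F.P k) 0 (Node00.SU N) → ℝ) (hg : ∀ k U U', 0 ≤ gauge k U U')
    (T : (k : ℕ) → GaugeField (F.P (k + 1)) 0 (Node00.SU N) → GaugeField (F.P k) 0 (Node00.SU N)) (li : LetterInputs) (k : ℕ) :
    N22At (u3OfRecord₁₃ θ ((ReadingData.ofRecord F M N S gauge hg T li).u3ObjectsAllRuns γ) k) ↔
      ∀ K, N22At (u3OfRecord₁₃ θ ((ReadingData.ofRecord F M N S gauge hg T li).u3Objects γ) K) :=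
  n22At_u3OfRecord₁₃_allRuns_iff θ _ γ (nonempty_bgA_pairing_ofRecord F M S gauge hg T li) k

/-- **THE GUARD AT THE ALL-RUNS FUNCTIONAL OF THE READING OF RECORD ⟺ SOME RUN LENGTH's LEVEL FUNCTIONAL PASSES IT** — no inhabitant hypothesis left. [folklore] -/
theorem sensitiveOnBoxes_allRuns_ofRecord_iff (S : (k : ℕ) → ClusterTower (F.P k) (MatA N) M)
    (gauge : (k : ℕ) → GaugeField (F.P k) 0 (Node00.SU N) → GaugeField (F.P k) 0 (Node00.SU N) → ℝ) (hg : ∀ k U U', 0 ≤ gauge k U U')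
    (T : (k : ℕ) → GaugeField (F.P (k + 1)) 0 (Node00.SU N) → GaugeField (F.P k) 0 (Node00.SU N)) (li : LetterInputs) (γb : ℝ) :
    SensitiveOnBoxes (ReadingData.ofRecord F M N S gauge hg T li).allRunsEA γb ↔
      ∃ K, SensitiveOnBoxes (((ReadingData.ofRecord F M N S gauge hg T li).u3Objects γ).EA K) γb :=
  sensitiveOnBoxes_allRuns_iff _ γ (nonempty_bgA_pairing_ofRecord F M S gauge hg T li) γb

variable (S : (k : ℕ) → ClusterTower (F.P k) (MatA N) M) (sp : (k j : ℕ) → (domSys (F.P k) M j).Dom → Set (CPair (F.P k) (MatA N)))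
  (gauge : (k : ℕ) → GaugeField (F.P k) 0 (Node00.SU N) → GaugeField (F.P k) 0 (Node00.SU N) → ℝ) (hg : ∀ k U U', 0 ≤ gauge k U U')
  (T₀ : (k : ℕ) → GaugeField (F.P (k + 1)) 0 (Node00.SU N) → GaugeField (F.P k) 0 (Node00.SU N))
  (hT₀ : ∀ (k : ℕ) (U : GaugeField (F.P (k + 1)) 0 (Node00.SU N)), (∀ (j : ℕ) (Y : (domSys (F.P (k + 1)) M j).Dom), ofBackgroundC (ιSU N) U ∈ sp (k + 1) j Y) →
    ∀ (j : ℕ) (Y : (domSys (F.P k) M j).Dom), ofBackgroundC (ιSU N) (T₀ k U) ∈ sp k j Y)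
  (li : LetterInputs)

/-- **`N18At` AT THE ALL-RUNS BUNDLE OF THE ADMISSIBLE READING OF RECORD ⟺ AT EVERY RUN-LENGTH LEVEL**, under inhabitation of the space table at every run (one field
inside every space). [folklore] -/
theorem n18At_allRuns_ofRecordAdm_iff
    (hsp : ∀ K, ∃ U₀ : GaugeField (F.P K) 0 (Node00.SU N), ∀ (j : ℕ) (Y : (domSys (F.P K) M j).Dom), ofBackgroundC (ιSU N) U₀ ∈ sp K j Y) (k : ℕ) :
    N18At (u3OfRecord₁₃ θ ((ReadingData.ofRecordAdm F M N S sp gauge hg T₀ hT₀ li).u3ObjectsAllRuns γ) k) ↔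
      ∀ K, N18At (u3OfRecord₁₃ θ ((ReadingData.ofRecordAdm F M N S sp gauge hg T₀ hT₀ li).u3Objects γ) K) :=
  n18At_u3OfRecord₁₃_allRuns_iff θ _ γ (fun K => nonempty_bgB_pairing_ofRecordAdm F M S sp gauge hg T₀ hT₀ li K (hsp (K + 1))) k

/-- **`N22At` AT THE ALL-RUNS BUNDLE OF THE ADMISSIBLE READING OF RECORD ⟺ AT EVERY RUN-LENGTH LEVEL**, under table inhabitation. [folklore] -/
theorem n22At_allRuns_ofRecordAdm_iff
    (hsp : ∀ K, ∃ U₀ : GaugeField (F.P K) 0 (Node00.SU N), ∀ (j : ℕ) (Y : (domSys (F.P K) M j).Dom), ofBackgroundC (ιSU N) U₀ ∈ sp K j Y) (k : ℕ) :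
    N22At (u3OfRecord₁₃ θ ((ReadingData.ofRecordAdm F M N S sp gauge hg T₀ hT₀ li).u3ObjectsAllRuns γ) k) ↔
      ∀ K, N22At (u3OfRecord₁₃ θ ((ReadingData.ofRecordAdm F M N S sp gauge hg T₀ hT₀ li).u3Objects γ) K) :=
  n22At_u3OfRecord₁₃_allRuns_iff θ _ γ (fun K => nonempty_bgA_pairing_ofRecordAdm F M S sp gauge hg T₀ hT₀ li K (hsp K)) k

end Dictionary

end YMDAG.N18.AllRunsPinned

end
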